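import Literature.Analysis.FluidPDE.PassiveVectorWeakGradientHighModePairing
import Literature.Analysis.FluidPDE.PassiveVectorTensorGardingDivergence
import Literature.Analysis.FunctionSpaces.TorusFourierModes
import HarnessLib

/-!
# Gårding's inequality for HONEST `L²` WEAK GRADIENTS on `T^d` (constant Legendre–Hadamard tensor, with divergence) and its TWISTED form

Analysis/FluidPDE proof file (everything proved; no definitions, no named facts, no `sorry`).

`PassiveVectorTensorGardingDivergence` proves, for SMOOTH fields, `∫⟪ψ, 𝓛_𝔸^*ψ⟫ ≤ −(lo − η)‖∇ψ‖₂² + C∫(∇·ψ)²` (Giaquinta Ch. III §2 (2.2) ⇒ (2.6)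
with the longitudinal part kept) and its twisted version on `G`-solenoidal fields.  The (S2) rows of the `ad-ideate` K1L_D programme need the
same floor for the WEAK GRADIENT `Du ∈ L²` of an `L²` weak solution (the witnesses of the energy binders carry nothing more).  On the torus no
density argument is needed: the coordinate Fourier relation `𝓕((D c)ᵢ)(k) = 2πi k_c ûᵢ(k)` (`Torus.mFourierCoeff_coord_of_hasWeakPartialDeriv`) and
the polarised Parseval identity turn the bilinear gradient form into the modewise symbol series, where the modewise inequality
`Torus.re_inner_symbT_ge_of_nearIso_fullBound` applies term by term.
* §1 `hasSum_integral_mul_coord_weakGradient` — `∫ (D c)ᵢ (D e)ⱼ = Σₖ 4π² k_c k_e Re(conj ûᵢ(k) ûⱼ(k))`;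
* §2 `hasSum_integral_gradForm_weakGradient` — `∫ Σ 𝔸_{icje}(D c)ᵢ(D e)ⱼ = Σₖ 4π² Re⟪û(k), T_𝔸(k) û(k)⟫`;
* §3 `hasSum_integral_sum_sq_weakGradient` (`∫Σ‖D c‖² = Σₖ 4π²|k|²‖û(k)‖²`), `hasSum_integral_sq_weakDivergence` (`∫(Σ_c (D c)_c)² = Σₖ 4π²‖Σⱼ kⱼûⱼ(k)‖²`);
* §4 **`integral_gradForm_weakGradient_ge`** — for `NearIso 𝔸 lo hi`, `FullBound 𝔸 h`, `0 < η`: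
  `(lo − η)∫Σ‖D c‖² − (lo − η + h + h²/η)∫(Σ_c(D c)_c)² ≤ ∫ Σ 𝔸_{icje}(D c)ᵢ(D e)ⱼ`;
* §5 **`integral_gradForm_conj_weakGradient_ge`** — the TWISTED floor for a frame `|G − 1| ≤ θ` with continuous entries, given the pointwise twisted
  divergence identity `Σ_{c,i} G_{ci}(D c)ᵢ = 0` a.e. (the weak Piola identity of a `G`-solenoidal `u`, supplied by the consumer):
  `(lo − η − (lo − η + h + h²/η)(dθ)² − h(2dθ + (dθ)²))∫Σ‖D c‖² ≤ ∫ Σ (𝔸^{G})_{icje}(D c)ᵢ(D e)ⱼ`.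
Consumer: cell `ad-ideate`, tool (T2) of `HOME/ad-k1loc-p3/S2-NOTE-p3g12.md`.

## Mathlib / tree search
Tree: `hasSum_conj_mul_mFourierCoeff`, `memLp_ofReal_apply`, `mFourierCoeff_complexify_apply` (`TorusVectorParseval`, `TorusSobolevNorm`),
`mFourierCoeff_coord_of_hasWeakPartialDeriv`, `eGradNormSq_eq_lintegral_of_hasWeakPartialDeriv` (`PassiveVectorWeakGradientHighModePairing`),
`re_inner_symbT_ge_of_nearIso_fullBound`, `fullBound_majorTranspose`, `symbT_apply` (`PassiveVectorTensorGardingDivergence`, `PassiveVectorTensorFourier`),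
`abs_gradForm_conj_sub_le`, `gradForm_eq_sum_mul_mul` (`PassiveVectorTensorDistortedTwistedCoercivity`), `mFourierCoeff_finset_sum` (`TorusFourierModes`).
Mathlib: `Complex.hasSum_re`, `hasSum_le`, `integral_complex_ofReal`.

## References
* M. Giaquinta, *Multiple integrals in the calculus of variations and nonlinear elliptic systems* (Princeton 1983), Ch. III §2 (2.1)–(2.6). [`Giaquinta1983MultipleIntegrals`]
* L. Grafakos, *Classical Fourier Analysis*, 3rd ed. (2014), Prop. 3.2.6 (8), Prop. 3.2.7 (3). [`Grafakos2014`]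
* S. Armstrong, V. Vicol, *Anomalous diffusion by fractal homogenization*, Ann. PDE (2025), §4.1. [`ArmstrongVicol2025`]
-/

open MeasureTheory Set Filter Topology UnitAddTorus
open scoped ENNReal NNReal ComplexConjugate InnerProductSpace

noncomputable section

namespace Literature.Analysis.FluidPDE

namespace Torus

open Literature.Analysis.FunctionSpaces Literature.Analysis.FunctionSpaces.Torus

variable {d : Type*} [Fintype d] [DecidableEq d]
variable {v : UnitAddTorus d → EuclideanSpace ℝ d} {D : d → UnitAddTorus d → EuclideanSpace ℝ d}

/-! ## §1 Polarised Parseval for pairs of weak-gradient components -/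

omit [DecidableEq d] in
/-- The product of coefficients of two weak-gradient components: `conj(2πi k_c z) · (2πi k_e w) = 4π² k_c k_e · conj(z) w`. [folklore] -/
private theorem conj_coeff_mul_coeff (kc ke : ℤ) (z w : ℂ) :
    starRingEnd ℂ ((2 * Real.pi * Complex.I * (kc : ℂ)) * z) * ((2 * Real.pi * Complex.I * (ke : ℂ)) * w)
      = ((4 * Real.pi ^ 2 * ((kc : ℝ) * (ke : ℝ)) : ℝ) : ℂ) * (starRingEnd ℂ z * w) := by
  simp only [map_mul, Complex.conj_ofReal, Complex.conj_I, map_ofNat, map_intCast]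
  push_cast
  have hI : Complex.I * Complex.I = -1 := Complex.I_mul_I
  linear_combination (2 * (Real.pi : ℂ) * (kc : ℂ)) * (2 * (Real.pi : ℂ) * (ke : ℂ)) * (starRingEnd ℂ z * w) * (-hI)

/-- **`∫ (D c)ᵢ (D e)ⱼ = Σₖ 4π² k_c k_e Re(conj ûᵢ(k) ûⱼ(k))`** for an honest `L²` weak gradient. [cite: Grafakos2014, Prop. 3.2.7 (3)] -/
theorem hasSum_integral_mul_coord_weakGradient (hv : MemLp v 2 volume) (hD : ∀ j, MemLp (D j) 2 volume)
    (hw : ∀ j, HasWeakPartialDeriv j v (D j)) (c e i j : d) :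
    HasSum (fun k : d → ℤ => 4 * Real.pi ^ 2 * ((k c : ℝ) * (k e : ℝ)) *
        (starRingEnd ℂ (mFourierCoeff (fun x => (v x i : ℂ)) k) * mFourierCoeff (fun x => (v x j : ℂ)) k).re)
      (∫ x, (D c x) i * (D e x) j) := by
  have hf : MemLp (fun x => ((D c x) i : ℂ)) 2 volume := memLp_ofReal_apply (hD c) i
  have hg : MemLp (fun x => ((D e x) j : ℂ)) 2 volume := memLp_ofReal_apply (hD e) j
  have H := hasSum_conj_mul_mFourierCoeff hf hg
  have ecoef : (fun k : d → ℤ => starRingEnd ℂ (mFourierCoeff (fun x => ((D c x) i : ℂ)) k) * mFourierCoeff (fun x => ((D e x) j : ℂ)) k)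
      = fun k => ((4 * Real.pi ^ 2 * ((k c : ℝ) * (k e : ℝ)) : ℝ) : ℂ) *
          (starRingEnd ℂ (mFourierCoeff (fun x => (v x i : ℂ)) k) * mFourierCoeff (fun x => (v x j : ℂ)) k) := by
    funext k
    rw [mFourierCoeff_coord_of_hasWeakPartialDeriv hv (hD c) (hw c) i k, mFourierCoeff_coord_of_hasWeakPartialDeriv hv (hD e) (hw e) j k]
    exact conj_coeff_mul_coeff (k c) (k e) _ _
  have eint : ∫ x, starRingEnd ℂ (((D c x) i : ℝ) : ℂ) * (((D e x) j : ℝ) : ℂ) = ((∫ x, (D c x) i * (D e x) j : ℝ) : ℂ) := by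
    rw [← integral_complex_ofReal]
    exact integral_congr_ae (Eventually.of_forall fun x => by simp only [Complex.conj_ofReal]; push_cast; ring)
  rw [ecoef, eint] at H
  have H2 := Complex.hasSum_re H
  simp only [Complex.ofReal_re, Complex.re_ofReal_mul] at H2
  exact H2

/-! ## §2 The bilinear gradient form as the symbol series -/

omit [DecidableEq d] in
/-- `Σ_{iajb} 𝔸 iajb k_a k_b Re(conj zᵢ zⱼ) = Re⟪z, T_𝔸(k) z⟫` (`= symb 𝔸 k (Re z) + symb 𝔸 k (Im z)`, `re_inner_symbT_eq`).
[cite: Frisch1995Turbulence, §9.6.3 eq. (9.57) p. 233] -/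
theorem sum_coeff_re_conj_mul_eq_re_inner_symbT (𝔸 : Visc4 d) (k : d → ℤ) (z : EuclideanSpace ℂ d) :
    ∑ i, ∑ a, ∑ j, ∑ b, 𝔸 i a j b * ((k a : ℝ) * (k b : ℝ)) * (starRingEnd ℂ (z i) * z j).re = (⟪z, symbT 𝔸 k z⟫_ℂ).re := by
  rw [re_inner_symbT_eq, symb, symb, ← Finset.sum_add_distrib]
  refine Finset.sum_congr rfl fun i _ => ?_
  rw [← Finset.sum_add_distrib]
  refine Finset.sum_congr rfl fun a _ => ?_
  rw [← Finset.sum_add_distrib]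
  refine Finset.sum_congr rfl fun j _ => ?_
  rw [← Finset.sum_add_distrib]
  refine Finset.sum_congr rfl fun b _ => ?_
  have : (starRingEnd ℂ (z i) * z j).re = (z i).re * (z j).re + (z i).im * (z j).im := by
    rw [Complex.mul_re, Complex.conj_re, Complex.conj_im]; ring
  rw [this]; ring

omit [DecidableEq d] in
/-- The integrand of the bilinear gradient form is integrable (products of `L²` components). [folklore] -/
private theorem integrable_coord_mul (hD : ∀ j, MemLp (D j) 2 volume) (c e i j : d) :
    Integrable (fun x => (D c x) i * (D e x) j) volume :=
  ((hD c).eval_piLp i).integrable_mul ((hD e).eval_piLp j)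

/-- **`∫ Σ 𝔸_{iajb}(D a)ᵢ(D b)ⱼ = Σₖ 4π² Re⟪û(k), T_𝔸(k) û(k)⟫`** for an honest `L²` weak gradient (`û` = complexified coefficients).
[cite: Giaquinta1983MultipleIntegrals, Ch. III §2 eq. (2.2)–(2.6)] -/
theorem hasSum_integral_gradForm_weakGradient (𝔸 : Visc4 d) (hv : MemLp v 2 volume) (hD : ∀ j, MemLp (D j) 2 volume)
    (hw : ∀ j, HasWeakPartialDeriv j v (D j)) :
    HasSum (fun k : d → ℤ => 4 * Real.pi ^ 2 *
        (⟪mFourierCoeff (EuclideanSpace.complexify ∘ v) k, symbT 𝔸 k (mFourierCoeff (EuclideanSpace.complexify ∘ v) k)⟫_ℂ).re)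
      (∫ x, ∑ i, ∑ a, ∑ j, ∑ b, 𝔸 i a j b * (D a x) i * (D b x) j) := by
  have hvi : Integrable v volume := hv.integrable one_le_two
  -- termwise series
  have hterm : ∀ i a j b, HasSum (fun k : d → ℤ => 𝔸 i a j b * (4 * Real.pi ^ 2 * ((k a : ℝ) * (k b : ℝ)) *
      (starRingEnd ℂ (mFourierCoeff (fun x => (v x i : ℂ)) k) * mFourierCoeff (fun x => (v x j : ℂ)) k).re))
      (𝔸 i a j b * ∫ x, (D a x) i * (D b x) j) :=
    fun i a j b => (hasSum_integral_mul_coord_weakGradient hv hD hw a b i j).mul_left _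
  have hsum := hasSum_sum (s := Finset.univ) fun i _ => hasSum_sum (s := Finset.univ) fun a _ =>
    hasSum_sum (s := Finset.univ) fun j _ => hasSum_sum (s := Finset.univ) fun b _ => hterm i a j b
  -- the value: sum of integrals = integral of the sum
  have hval : ∑ i, ∑ a, ∑ j, ∑ b, 𝔸 i a j b * ∫ x, (D a x) i * (D b x) j = ∫ x, ∑ i, ∑ a, ∑ j, ∑ b, 𝔸 i a j b * (D a x) i * (D b x) j := by
    have hI : ∀ i a j b, Integrable (fun x => 𝔸 i a j b * (D a x) i * (D b x) j) volume := fun i a j b =>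
      ((integrable_coord_mul hD a b i j).const_mul (𝔸 i a j b)).congr (Eventually.of_forall fun x => by simp only; ring)
    rw [integral_finsetSum _ fun i _ => integrable_finsetSum _ fun a _ => integrable_finsetSum _ fun j _ => integrable_finsetSum _ fun b _ => hI i a j b]
    refine Finset.sum_congr rfl fun i _ => ?_
    rw [integral_finsetSum _ fun a _ => integrable_finsetSum _ fun j _ => integrable_finsetSum _ fun b _ => hI i a j b]
    refine Finset.sum_congr rfl fun a _ => ?_
    rw [integral_finsetSum _ fun j _ => integrable_finsetSum _ fun b _ => hI i a j b]
    refine Finset.sum_congr rfl fun j _ => ?_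
    rw [integral_finsetSum _ fun b _ => hI i a j b]
    refine Finset.sum_congr rfl fun b _ => ?_
    rw [← integral_const_mul]
    exact integral_congr_ae (Eventually.of_forall fun x => by simp only; ring)
  rw [hval] at hsum
  refine hsum.congr_fun fun k => ?_
  -- termwise: Σ 𝔸 (4π² k_a k_b Re(conj ûᵢ ûⱼ)) = 4π² Re⟪û, T_𝔸 û⟫
  rw [← sum_coeff_re_conj_mul_eq_re_inner_symbT, Finset.mul_sum]
  refine Finset.sum_congr rfl fun i _ => ?_
  rw [Finset.mul_sum]
  refine Finset.sum_congr rfl fun a _ => ?_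
  rw [Finset.mul_sum]
  refine Finset.sum_congr rfl fun j _ => ?_
  rw [Finset.mul_sum]
  refine Finset.sum_congr rfl fun b _ => ?_
  rw [mFourierCoeff_complexify_apply hvi k i, mFourierCoeff_complexify_apply hvi k j]
  ring

/-! ## §3 The two norm series -/

/-- **`∫ Σ_c ‖D c‖² = Σₖ 4π²|k|²‖û(k)‖²`** for an honest `L²` weak gradient. [cite: Grafakos2014, Prop. 3.2.7 (3)] -/
theorem hasSum_integral_sum_sq_weakGradient (hv : MemLp v 2 volume) (hD : ∀ j, MemLp (D j) 2 volume)
    (hw : ∀ j, HasWeakPartialDeriv j v (D j)) :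
    HasSum (fun k : d → ℤ => 4 * Real.pi ^ 2 * (freqNormSq k * ‖mFourierCoeff (EuclideanSpace.complexify ∘ v) k‖ ^ 2))
      (∫ x, ∑ c, ‖D c x‖ ^ 2) := by
  have hvi : Integrable v volume := hv.integrable one_le_two
  have hterm : ∀ c i, HasSum (fun k : d → ℤ => 4 * Real.pi ^ 2 * ((k c : ℝ) * (k c : ℝ)) *
      (starRingEnd ℂ (mFourierCoeff (fun x => (v x i : ℂ)) k) * mFourierCoeff (fun x => (v x i : ℂ)) k).re)
      (∫ x, (D c x) i * (D c x) i) := fun c i => hasSum_integral_mul_coord_weakGradient hv hD hw c c i i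
  have hsum := hasSum_sum (s := Finset.univ) fun c _ => hasSum_sum (s := Finset.univ) fun i _ => hterm c i
  have hval : ∑ c, ∑ i, ∫ x, (D c x) i * (D c x) i = ∫ x, ∑ c, ‖D c x‖ ^ 2 := by
    rw [integral_finsetSum _ fun c _ => ((hD c).integrable_norm_pow two_ne_zero)]
    refine Finset.sum_congr rfl fun c _ => ?_
    rw [← integral_finsetSum _ fun i _ => integrable_coord_mul hD c c i i]
    refine integral_congr_ae (Eventually.of_forall fun x => ?_)
    beta_reduce
    rw [EuclideanSpace.norm_sq_eq]
    exact Finset.sum_congr rfl fun i _ => by rw [Real.norm_eq_abs, sq_abs, sq]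
  rw [hval] at hsum
  refine hsum.congr_fun fun k => ?_
  rw [freqNormSq, Finset.sum_mul, Finset.mul_sum]
  refine Finset.sum_congr rfl fun c _ => ?_
  rw [EuclideanSpace.norm_sq_eq, Finset.mul_sum, Finset.mul_sum]
  refine Finset.sum_congr rfl fun i _ => ?_
  rw [mFourierCoeff_complexify_apply hvi k i, Complex.conj_mul', ← Complex.ofReal_pow, Complex.ofReal_re]
  ring

/-- **`∫ (Σ_c (D c)_c)² = Σₖ 4π²‖Σⱼ kⱼ ûⱼ(k)‖²`** (Parseval for the weak divergence). [cite: Grafakos2014, Prop. 3.2.7 (3)] -/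
theorem hasSum_integral_sq_weakDivergence (hv : MemLp v 2 volume) (hD : ∀ j, MemLp (D j) 2 volume)
    (hw : ∀ j, HasWeakPartialDeriv j v (D j)) :
    HasSum (fun k : d → ℤ => 4 * Real.pi ^ 2 * ‖∑ j, (k j : ℂ) * mFourierCoeff (EuclideanSpace.complexify ∘ v) k j‖ ^ 2)
      (∫ x, (∑ c, (D c x) c) ^ 2) := by
  have hvi : Integrable v volume := hv.integrable one_le_two
  have hterm : ∀ c e, HasSum (fun k : d → ℤ => 4 * Real.pi ^ 2 * ((k c : ℝ) * (k e : ℝ)) *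
      (starRingEnd ℂ (mFourierCoeff (fun x => (v x c : ℂ)) k) * mFourierCoeff (fun x => (v x e : ℂ)) k).re)
      (∫ x, (D c x) c * (D e x) e) := fun c e => hasSum_integral_mul_coord_weakGradient hv hD hw c e c e
  have hsum := hasSum_sum (s := Finset.univ) fun c _ => hasSum_sum (s := Finset.univ) fun e _ => hterm c e
  have hval : ∑ c, ∑ e, ∫ x, (D c x) c * (D e x) e = ∫ x, (∑ c, (D c x) c) ^ 2 := by
    have h1 : ∀ c, ∑ e, ∫ x, (D c x) c * (D e x) e = ∫ x, ∑ e, (D c x) c * (D e x) e :=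
      fun c => (integral_finsetSum _ fun e _ => integrable_coord_mul hD c e c e).symm
    simp only [h1]
    rw [← integral_finsetSum _ fun c _ => integrable_finsetSum _ fun e _ => integrable_coord_mul hD c e c e]
    refine integral_congr_ae (Eventually.of_forall fun x => ?_)
    beta_reduce
    rw [sq, Finset.sum_mul_sum]
  rw [hval] at hsum
  refine hsum.congr_fun fun k => ?_
  -- termwise: Σ_c Σ_e 4π² k_c k_e Re(conj û_c û_e) = 4π² ‖Σ_j k_j û_j‖²
  set w : d → ℂ := fun j => mFourierCoeff (EuclideanSpace.complexify ∘ v) k j with hwdef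
  have hw' : ∀ j, mFourierCoeff (fun x => (v x j : ℂ)) k = w j := fun j => (mFourierCoeff_complexify_apply hvi k j).symm
  simp only [hw']
  have hS : ‖∑ j, (k j : ℂ) * w j‖ ^ 2 = ∑ c, ∑ e, ((k c : ℝ) * (k e : ℝ)) * (starRingEnd ℂ (w c) * w e).re := by
    have e1 : (‖∑ j, (k j : ℂ) * w j‖ ^ 2 : ℝ) = (starRingEnd ℂ (∑ j, (k j : ℂ) * w j) * ∑ j, (k j : ℂ) * w j).re := by
      rw [Complex.conj_mul', ← Complex.ofReal_pow, Complex.ofReal_re]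
    rw [e1, map_sum, Finset.sum_mul_sum, Complex.re_sum]
    refine Finset.sum_congr rfl fun c _ => ?_
    rw [Complex.re_sum]
    refine Finset.sum_congr rfl fun e _ => ?_
    rw [map_mul, map_intCast]
    have e2 : (k c : ℂ) * starRingEnd ℂ (w c) * ((k e : ℂ) * w e) = (((k c : ℝ) * (k e : ℝ) : ℝ) : ℂ) * (starRingEnd ℂ (w c) * w e) := by
      push_cast; ring
    rw [e2, Complex.re_ofReal_mul]
  rw [hS, Finset.mul_sum]
  refine Finset.sum_congr rfl fun c _ => ?_
  rw [Finset.mul_sum]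
  exact Finset.sum_congr rfl fun e _ => by ring


/-! ## §4 Gårding's inequality with divergence for weak gradients -/

/-- **GÅRDING WITH DIVERGENCE FOR AN HONEST `L²` WEAK GRADIENT** (constant Legendre–Hadamard tensor): for `NearIso 𝔸 lo hi`, `FullBound 𝔸 h`, `0 < η`,
`(lo − η)∫Σ_c‖D c‖² − (lo − η + h + h²/η)∫(Σ_c (D c)_c)² ≤ ∫ Σ 𝔸_{iajb} (D a)ᵢ (D b)ⱼ` (the modewise inequality summed by Parseval; no smoothness).
[cite: Giaquinta1983MultipleIntegrals, Ch. III §2 eq. (2.2)–(2.6)] -/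
theorem integral_gradForm_weakGradient_ge {𝔸 : Visc4 d} {lo hi h η : ℝ} (hN : NearIso 𝔸 lo hi) (hB : FullBound 𝔸 h) (hη : 0 < η)
    (hv : MemLp v 2 volume) (hD : ∀ j, MemLp (D j) 2 volume) (hw : ∀ j, HasWeakPartialDeriv j v (D j)) :
    (lo - η) * (∫ x, ∑ c, ‖D c x‖ ^ 2) - (lo - η + h + h ^ 2 / η) * ∫ x, (∑ c, (D c x) c) ^ 2
      ≤ ∫ x, ∑ i, ∑ a, ∑ j, ∑ b, 𝔸 i a j b * (D a x) i * (D b x) j := by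
  have hQ := hasSum_integral_gradForm_weakGradient 𝔸 hv hD hw
  have hG := hasSum_integral_sum_sq_weakGradient hv hD hw
  have hDiv := hasSum_integral_sq_weakDivergence hv hD hw
  have hL := (hG.mul_left (lo - η)).sub (hDiv.mul_left (lo - η + h + h ^ 2 / η))
  refine hasSum_le (fun k => ?_) hL hQ
  have hm := re_inner_symbT_ge_of_nearIso_fullBound hN hB hη k (mFourierCoeff (EuclideanSpace.complexify ∘ v) k)
  have hπ : 0 ≤ 4 * Real.pi ^ 2 := by positivity
  have h2 := mul_le_mul_of_nonneg_left hm hπ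
  simp only at h2 ⊢
  linarith

/-! ## §5 The twisted floor under the weak Piola identity -/

omit [Fintype d] [DecidableEq d] in
/-- A continuous real function on the torus is bounded. [folklore] -/
private theorem exists_bound_of_continuous₇ {f : UnitAddTorus d → ℝ} (hf : Continuous f) : ∃ C, ∀ x, |f x| ≤ C := by
  obtain ⟨C, hC⟩ := isCompact_univ.exists_bound_of_continuousOn (hf.continuousOn (s := univ))
  exact ⟨C, fun x => by simpa [Real.norm_eq_abs] using hC x (mem_univ x)⟩

omit [DecidableEq d] in
/-- `(Σ_c Σ_i a_{ci})² ≤ d² Σ_c Σ_i a_{ci}²`. [folklore] -/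
private theorem sq_sum_sum_le (a : d → d → ℝ) : (∑ c, ∑ i, a c i) ^ 2 ≤ (Fintype.card d : ℝ) ^ 2 * ∑ c, ∑ i, a c i ^ 2 := by
  have h1 : (∑ c, ∑ i, a c i) ^ 2 ≤ Fintype.card d * ∑ c, (∑ i, a c i) ^ 2 := by
    have := sq_sum_le_card_mul_sum_sq (s := Finset.univ) (f := fun c => ∑ i, a c i)
    simpa using this
  have h2 : ∀ c, (∑ i, a c i) ^ 2 ≤ Fintype.card d * ∑ i, a c i ^ 2 := fun c => by
    have := sq_sum_le_card_mul_sum_sq (s := Finset.univ) (f := fun i => a c i)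
    simpa using this
  calc (∑ c, ∑ i, a c i) ^ 2 ≤ Fintype.card d * ∑ c, (∑ i, a c i) ^ 2 := h1
    _ ≤ Fintype.card d * ∑ c, (Fintype.card d * ∑ i, a c i ^ 2) :=
        mul_le_mul_of_nonneg_left (Finset.sum_le_sum fun c _ => h2 c) (Nat.cast_nonneg _)
    _ = (Fintype.card d : ℝ) ^ 2 * ∑ c, ∑ i, a c i ^ 2 := by rw [← Finset.mul_sum]; ring

/-- **THE TWISTED GÅRDING FLOOR FOR AN HONEST `L²` WEAK GRADIENT.**  For `NearIso 𝔸 lo hi`, `FullBound 𝔸 h`, `0 < η ≤ lo`, a frame `G` with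
continuous entries and `|G − 1| ≤ θ`, and `u ∈ L²` with weak gradient `D ∈ L²` satisfying the pointwise twisted divergence identity
`Σ_{c,i} G_{ci}(D c)ᵢ = 0` a.e. (the weak Piola identity of a `G`-solenoidal field):
`(lo − η − (lo − η + h + h²/η)(dθ)² − h(2dθ + (dθ)²)) ∫Σ‖D c‖² ≤ ∫ Σ (𝔸^{G(x)})_{iajb}(D a)ᵢ(D b)ⱼ`.
[cite: Giaquinta1983MultipleIntegrals, Ch. III §2 eq. (2.2)–(2.6)] [cite: ArmstrongVicol2025, §4.1 (s_{m−1}, T_{m−1}), PDF p. 34] -/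
theorem integral_gradForm_conj_weakGradient_ge {𝔸 : Visc4 d} {lo hi h η θ : ℝ} (hN : NearIso 𝔸 lo hi) (hB : FullBound 𝔸 h)
    (hh : 0 ≤ h) (hη : 0 < η) (hηlo : η ≤ lo) {G : UnitAddTorus d → Matrix d d ℝ} (hGc : ∀ c a, Continuous fun y => G y c a)
    (hθ : 0 ≤ θ) (hG1 : ∀ y c a, |G y c a - (1 : Matrix d d ℝ) c a| ≤ θ)
    (hv : MemLp v 2 volume) (hD : ∀ j, MemLp (D j) 2 volume) (hw : ∀ j, HasWeakPartialDeriv j v (D j))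
    (hPiola : ∀ᵐ x ∂volume, ∑ c, ∑ i, G x c i * (D c x) i = 0) :
    (lo - η - (lo - η + h + h ^ 2 / η) * (Fintype.card d * θ) ^ 2 - h * (2 * (Fintype.card d * θ) + (Fintype.card d * θ) ^ 2))
        * ∫ x, ∑ c, ‖D c x‖ ^ 2
      ≤ ∫ x, ∑ i, ∑ a, ∑ j, ∑ b, Visc4.conj (G x) 𝔸 i a j b * (D a x) i * (D b x) j := by
  have hflat := integral_gradForm_weakGradient_ge hN hB hη hv hD hw
  have hC0 : 0 ≤ lo - η + h + h ^ 2 / η := by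
    have hq : 0 ≤ h ^ 2 / η := by positivity
    linarith
  obtain ⟨K, hK⟩ : ∃ K : ℝ, K = h * (2 * (Fintype.card d * θ) + (Fintype.card d * θ) ^ 2) := ⟨_, rfl⟩
  rw [← hK]
  -- integrability
  have hsq : Integrable (fun x => ∑ c, ‖D c x‖ ^ 2) volume := integrable_finsetSum _ fun c _ => (hD c).integrable_norm_pow two_ne_zero
  have hflatI : Integrable (fun x => ∑ i, ∑ a, ∑ j, ∑ b, 𝔸 i a j b * (D a x) i * (D b x) j) volume :=
    integrable_finsetSum _ fun i _ => integrable_finsetSum _ fun a _ => integrable_finsetSum _ fun j _ => integrable_finsetSum _ fun b _ =>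
      ((integrable_coord_mul hD a b i j).const_mul (𝔸 i a j b)).congr (Eventually.of_forall fun x => by simp only; ring)
  have hconjI : Integrable (fun x => ∑ i, ∑ a, ∑ j, ∑ b, Visc4.conj (G x) 𝔸 i a j b * (D a x) i * (D b x) j) volume := by
    refine integrable_finsetSum _ fun i _ => integrable_finsetSum _ fun a _ => integrable_finsetSum _ fun j _ => integrable_finsetSum _ fun b _ => ?_
    have hcont : Continuous fun x => Visc4.conj (G x) 𝔸 i a j b := by
      simp only [Visc4.conj_apply]
      exact continuous_finsetSum _ fun a' _ => continuous_finsetSum _ fun b' _ => ((hGc a a').mul continuous_const).mul (hGc b b')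
    obtain ⟨B, hBd⟩ := exists_bound_of_continuous₇ hcont
    have h := (integrable_coord_mul hD a b i j).bdd_mul hcont.aestronglyMeasurable (c := B)
      (Eventually.of_forall fun x => by rw [Real.norm_eq_abs]; exact hBd x)
    exact h.congr (Eventually.of_forall fun x => by ring)
  -- (i) twisted comparison, pointwise then integrated
  have hcmp : (∫ x, ∑ i, ∑ a, ∑ j, ∑ b, 𝔸 i a j b * (D a x) i * (D b x) j) - K * ∫ x, ∑ c, ‖D c x‖ ^ 2
      ≤ ∫ x, ∑ i, ∑ a, ∑ j, ∑ b, Visc4.conj (G x) 𝔸 i a j b * (D a x) i * (D b x) j := by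
    have e : ∫ x, (∑ i, ∑ a, ∑ j, ∑ b, 𝔸 i a j b * (D a x) i * (D b x) j - K * ∑ c, ‖D c x‖ ^ 2)
        = (∫ x, ∑ i, ∑ a, ∑ j, ∑ b, 𝔸 i a j b * (D a x) i * (D b x) j) - K * ∫ x, ∑ c, ‖D c x‖ ^ 2 := by
      rw [integral_sub hflatI (hsq.const_mul K), integral_const_mul]
    rw [← e]
    refine integral_mono (hflatI.sub (hsq.const_mul K)) hconjI fun x => ?_
    have h := abs_gradForm_conj_sub_le hB hh (G := G x) hθ (fun c a => hG1 x c a) (fun i a => (D a x) i)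
    rw [gradForm_eq_sum_mul_mul, gradForm_eq_sum_mul_mul] at h
    have hxx : ∑ i, ∑ a, ((D a x) i) ^ 2 = ∑ c, ‖D c x‖ ^ 2 := by
      rw [Finset.sum_comm]
      exact Finset.sum_congr rfl fun a _ => by
        rw [EuclideanSpace.norm_sq_eq]; exact Finset.sum_congr rfl fun i _ => by rw [Real.norm_eq_abs, sq_abs]
    rw [hxx, ← hK] at h
    simp only
    have := (abs_sub_le_iff.1 h).2
    linarith
  -- (ii) the divergence under the weak Piola identity
  have hdiv : ∫ x, (∑ c, (D c x) c) ^ 2 ≤ (Fintype.card d * θ) ^ 2 * ∫ x, ∑ c, ‖D c x‖ ^ 2 := by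
    rw [← integral_const_mul]
    refine integral_mono_ae ?_ (hsq.const_mul _) ?_
    · have hS : MemLp (fun x => ∑ c, (D c x) c) 2 volume := memLp_finsetSum _ fun c _ => (hD c).eval_piLp c
      exact (hS.integrable_mul hS).congr (Eventually.of_forall fun x => by simp only [Pi.mul_apply]; ring)
    · filter_upwards [hPiola] with x hx
      have e : ∑ c, (D c x) c = -∑ c, ∑ i, (G x c i - (1 : Matrix d d ℝ) c i) * (D c x) i := by
        have e2 : ∀ c, ∑ i, (1 : Matrix d d ℝ) c i * (D c x) i = (D c x) c := fun c => by simp [Matrix.one_apply]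
        have e1 : ∑ c, ∑ i, (G x c i - (1 : Matrix d d ℝ) c i) * (D c x) i = ∑ c, ∑ i, G x c i * (D c x) i - ∑ c, (D c x) c := by
          rw [← Finset.sum_sub_distrib]
          refine Finset.sum_congr rfl fun c _ => ?_
          rw [← e2 c, ← Finset.sum_sub_distrib]
          exact Finset.sum_congr rfl fun i _ => by ring
        rw [e1, hx]; ring
      rw [e, neg_sq]
      calc (∑ c, ∑ i, (G x c i - (1 : Matrix d d ℝ) c i) * (D c x) i) ^ 2
          ≤ (Fintype.card d : ℝ) ^ 2 * ∑ c, ∑ i, ((G x c i - (1 : Matrix d d ℝ) c i) * (D c x) i) ^ 2 := sq_sum_sum_le _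
        _ ≤ (Fintype.card d : ℝ) ^ 2 * ∑ c, ∑ i, (θ ^ 2 * ((D c x) i) ^ 2) := by
            refine mul_le_mul_of_nonneg_left (Finset.sum_le_sum fun c _ => Finset.sum_le_sum fun i _ => ?_) (by positivity)
            rw [mul_pow]
            refine mul_le_mul_of_nonneg_right ?_ (sq_nonneg _)
            rw [← sq_abs]; exact pow_le_pow_left₀ (abs_nonneg _) (hG1 x c i) 2
        _ = (Fintype.card d * θ) ^ 2 * ∑ c, ‖D c x‖ ^ 2 := by
            rw [mul_pow]
            have : ∑ c, ∑ i, θ ^ 2 * ((D c x) i) ^ 2 = θ ^ 2 * ∑ c, ‖D c x‖ ^ 2 := by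
              rw [Finset.mul_sum]
              refine Finset.sum_congr rfl fun c _ => ?_
              rw [EuclideanSpace.norm_sq_eq, Finset.mul_sum]
              exact Finset.sum_congr rfl fun i _ => by rw [Real.norm_eq_abs, sq_abs]
            rw [this]; ring
  -- (iii) combine
  have hCdiv := mul_le_mul_of_nonneg_left hdiv hC0
  have e : (lo - η - (lo - η + h + h ^ 2 / η) * (Fintype.card d * θ) ^ 2 - K) * ∫ x, ∑ c, ‖D c x‖ ^ 2
      = ((lo - η) * ∫ x, ∑ c, ‖D c x‖ ^ 2) - (lo - η + h + h ^ 2 / η) * ((Fintype.card d * θ) ^ 2 * ∫ x, ∑ c, ‖D c x‖ ^ 2)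
        - K * ∫ x, ∑ c, ‖D c x‖ ^ 2 := by ring
  rw [e]
  linarith [hflat, hcmp, hCdiv]

end Torus

end Literature.Analysis.FluidPDE

end
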